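import Summits.HubbardSuperconductivity.HubbardSuperconductivity.Theorems.AnisotropyChordTransferFibre3FamilyASumCscSq

/-!
# Route `AnisotropyChord` / H0 rotor rung: PartN38 — the lattice identity `SumCscFourth` PROVED: `Σ_{n=1}^{L−1} 1/sin⁴(πn/L) = (L²−1)(L²+11)/45`

Typed target `SumCscFourth` of `…Fibre3FamilyALemmas` (PORT PartN38, theory seat `hubbard-h0-rotor-theory-1` g21, memo 21 §316).
Same Parseval mechanism as `sumCscSq_holds` (`…Fibre3FamilyASumCscSq`), one level up: the quadratic
`g(r) = (val r)² − (L−2)·val r)/2` has discrete derivative `val r − (L−1)/2`, so `(1 − conj φ(k))·ĝ(k) = FT[val](k)` off the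
zero mode and `|ĝ(k)|²·(4 sin²(πk/L))² = L²`; Parseval `Σ_k |ĝ(k)|² = L Σ_r g(r)²`, the zero mode `ĝ(0) = Σ_r g(r)`, and the
power sums `Σ i³`, `Σ i⁴` finish the computation.
Prover seat `hubbard-h0-rotor-p1` g23; helper for stmt-HubbardSuperconductivity-19089 (`--supports`).
-/

set_option linter.dupNamespace false
set_option autoImplicit false

noncomputable section

open scoped BigOperators
open Complex

namespace Summit.HubbardSuperconductivity.HubbardSuperconductivity.Theorems.AnisotropyChord.Transfer.Fibre3

variable (L : ℕ) [NeZero L]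

/-! ## Power sums -/

omit [NeZero L] in
/-- `4·Σ_{i<n} i³ = n²(n−1)²`. [folklore] -/
theorem sum_range_cube (n : ℕ) : ∑ i ∈ Finset.range n, ((i : ℝ)) ^ 3 = ((n : ℝ) * ((n : ℝ) - 1)) ^ 2 / 4 := by
  induction n with
  | zero => simp
  | succ n ih => rw [Finset.sum_range_succ, ih]; push_cast; ring

omit [NeZero L] in
/-- `30·Σ_{i<n} i⁴ = (n−1)n(2n−1)(3n²−3n−1)`. [folklore] -/
theorem sum_range_four (n : ℕ) :
    ∑ i ∈ Finset.range n, ((i : ℝ)) ^ 4 = ((n : ℝ) - 1) * n * (2 * n - 1) * (3 * (n : ℝ) ^ 2 - 3 * n - 1) / 30 := by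
  induction n with
  | zero => simp
  | succ n ih => rw [Finset.sum_range_succ, ih]; push_cast; ring

/-! ## The quadratic `g` and its transform -/

/-- `g(r) = ((val r)² − (L − 2)·val r)/2`. [folklore] -/
def gquad (r : ZMod L) : ℂ := ((((r.val : ℕ) : ℂ)) ^ 2 - ((L : ℂ) - 2) * ((r.val : ℕ) : ℂ)) / 2

/-- the discrete derivative of `g` is `val − (L−1)/2`. [folklore] -/
theorem gquad_sub_pred (r : ZMod L) :
    gquad L r - gquad L (r - 1) = ((r.val : ℕ) : ℂ) - ((L : ℂ) - 1) / 2 := by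
  unfold gquad
  by_cases hr : r = 0
  · rw [hr, ZMod.val_zero, zero_sub]
    have h := Literature.AlgebraicTopology.CellComplexes.CubicalTorus.val_add_one_of_eq (N := L) (a := -1) rfl
    have h' : (((-1 : ZMod L).val : ℕ) : ℂ) + 1 = (L : ℂ) := by exact_mod_cast h
    have e : (((-1 : ZMod L).val : ℕ) : ℂ) = (L : ℂ) - 1 := by linear_combination h'
    rw [e]; push_cast; ring
  · have hne : r - 1 ≠ -1 := by
      intro h; apply hr
      calc r = (r - 1) + 1 := (sub_add_cancel r 1).symm
        _ = -1 + 1 := by rw [h]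
        _ = 0 := neg_add_cancel 1
    have h := Literature.AlgebraicTopology.CellComplexes.CubicalTorus.val_add_one_of_ne (N := L) hne
    rw [sub_add_cancel] at h
    rw [h]; push_cast; ring

/-- off the zero mode a constant has no Fourier transform. [folklore] -/
theorem dft1_const {k : ZMod L} (hk : k ≠ 0) (c : ℂ) : dft1 L (fun _ => c) k = 0 := by
  unfold dft1
  rw [← Finset.sum_mul, ← map_sum]
  have hs : ∑ r : ZMod L, phZ L (k * r) = 0 := by
    have := sum_phZ_mul L k
    rw [if_neg hk] at this
    rw [← this]
    exact Finset.sum_congr rfl fun r _ => by rw [mul_comm]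
  rw [hs, map_zero, zero_mul]

/-- `(1 − conj φ(k))·ĝ(k) = FT[val](k)` for `k ≠ 0`. [folklore] -/
theorem dft1_gquad {k : ZMod L} (hk : k ≠ 0) :
    (1 - (starRingEnd ℂ) (phZ L k)) * dft1 L (gquad L) k = dft1 L (fun r => ((r.val : ℕ) : ℂ)) k := by
  rw [← dft1_bwdDiff]
  have e : dft1 L (fun r => gquad L r - gquad L (r - 1)) k
      = dft1 L (fun r => ((r.val : ℕ) : ℂ)) k - dft1 L (fun _ => ((L : ℂ) - 1) / 2) k := by
    unfold dft1
    rw [← Finset.sum_sub_distrib]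
    refine Finset.sum_congr rfl fun r _ => ?_
    beta_reduce
    rw [gquad_sub_pred]; ring
  rw [e, dft1_const L hk, sub_zero]

/-- the key Fourier fact one level up: `|ĝ(k)|²·(4 sin²(π val k/L))² = L²` for `k ≠ 0`. [folklore] -/
theorem normSq_dft1_gquad {k : ZMod L} (hk : k ≠ 0) :
    Complex.normSq (dft1 L (gquad L) k) * (4 * Real.sin (Real.pi * k.val / L) ^ 2) ^ 2 = (L : ℝ) ^ 2 := by
  have h1 := congrArg Complex.normSq (dft1_gquad L hk)
  rw [map_mul, ← Complex.normSq_conj (1 - (starRingEnd ℂ) (phZ L k)), map_sub, map_one, Complex.conj_conj,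
    normSq_one_sub_phZ] at h1
  have h2 := normSq_dft1_val L hk
  rw [← h1] at h2
  linarith [h2]

/-! ## `SumCscFourth` -/

/-- the identity over `ZMod L ∖ {0}`: `Σ_{k ≠ 0} 1/sin⁴(π val k/L) = (L² − 1)(L² + 11)/45`. [folklore] -/
theorem sum_inv_sin_four_zmod :
    ∑ k : ZMod L, (if k = 0 then (0 : ℝ) else 1 / Real.sin (Real.pi * k.val / L) ^ 4)
      = ((L : ℝ) ^ 2 - 1) * ((L : ℝ) ^ 2 + 11) / 45 := by
  classical
  have hL : (0 : ℝ) < L := by exact_mod_cast Nat.pos_of_ne_zero (NeZero.ne L)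
  -- Parseval for `g`
  have hP := parseval_zmod L (gquad L)
  have hgr : ∀ b : ℕ, b < L → Complex.normSq (gquad L (b : ZMod L)) = ((((b : ℝ)) ^ 2 - ((L : ℝ) - 2) * b) / 2) ^ 2 := by
    intro b hb
    unfold gquad
    rw [ZMod.val_natCast_of_lt hb,
      show ((((b : ℕ) : ℂ)) ^ 2 - ((L : ℂ) - 2) * ((b : ℕ) : ℂ)) / 2 = (((((b : ℝ)) ^ 2 - ((L : ℝ) - 2) * b) / 2 : ℝ) : ℂ) by
        push_cast; ring, Complex.normSq_ofReal]
    ring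
  have hR : ∑ r : ZMod L, Complex.normSq (gquad L r)
      = ∑ i ∈ Finset.range L, ((((i : ℝ)) ^ 2 - ((L : ℝ) - 2) * i) / 2) ^ 2 := by
    rw [Literature.AlgebraicTopology.CellComplexes.CubicalTorus.sum_univ_zmod (N := L)
      (fun r : ZMod L => Complex.normSq (gquad L r))]
    exact Finset.sum_congr rfl fun b hb => hgr b (Finset.mem_range.1 hb)
  -- the zero mode
  have h0 : Complex.normSq (dft1 L (gquad L) 0)
      = (∑ i ∈ Finset.range L, ((((i : ℝ)) ^ 2 - ((L : ℝ) - 2) * i) / 2)) ^ 2 := by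
    have : dft1 L (gquad L) 0 = (((∑ i ∈ Finset.range L, ((((i : ℝ)) ^ 2 - ((L : ℝ) - 2) * i) / 2)) : ℝ) : ℂ) := by
      unfold dft1
      simp only [zero_mul, phZ_zero, map_one, one_mul]
      rw [Literature.AlgebraicTopology.CellComplexes.CubicalTorus.sum_univ_zmod (N := L) (fun r : ZMod L => gquad L r)]
      push_cast
      refine Finset.sum_congr rfl fun b hb => ?_
      unfold gquad
      rw [ZMod.val_natCast_of_lt (Finset.mem_range.1 hb)]
    rw [this, Complex.normSq_ofReal]; ring
  -- nonzero modes
  have hsin : ∀ k : ZMod L, k ≠ 0 → 0 < Real.sin (Real.pi * k.val / L) := by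
    intro k hk
    have hv0 : 0 < (k.val : ℝ) := by exact_mod_cast Nat.pos_of_ne_zero ((ZMod.val_ne_zero k).mpr hk)
    have hvL : (k.val : ℝ) < L := by exact_mod_cast ZMod.val_lt k
    apply Real.sin_pos_of_pos_of_lt_pi
    · positivity
    · rw [div_lt_iff₀ hL]; nlinarith [Real.pi_pos]
  have hk : ∀ k : ZMod L, (if k = 0 then (0 : ℝ) else 1 / Real.sin (Real.pi * k.val / L) ^ 4)
      = (16 / (L : ℝ) ^ 2) * (Complex.normSq (dft1 L (gquad L) k)
          - (if k = 0 then Complex.normSq (dft1 L (gquad L) 0) else 0)) := by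
    intro k
    by_cases hk0 : k = 0
    · rw [if_pos hk0, if_pos hk0, hk0, sub_self, mul_zero]
    · rw [if_neg hk0, if_neg hk0, sub_zero]
      have e := normSq_dft1_gquad L hk0
      have hs := hsin k hk0
      have hs4 : 0 < Real.sin (Real.pi * k.val / L) ^ 4 := by positivity
      field_simp
      nlinarith [e]
  rw [Finset.sum_congr rfl fun k _ => hk k, ← Finset.mul_sum, Finset.sum_sub_distrib,
    Finset.sum_ite_eq' Finset.univ (0 : ZMod L)]
  simp only [Finset.mem_univ, if_true]
  rw [hP, hR, h0]
  -- expand the polynomial sums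
  have e2 : ∑ i ∈ Finset.range L, ((((i : ℝ)) ^ 2 - ((L : ℝ) - 2) * i) / 2) ^ 2
      = ((∑ i ∈ Finset.range L, ((i : ℝ)) ^ 4) - 2 * ((L : ℝ) - 2) * (∑ i ∈ Finset.range L, ((i : ℝ)) ^ 3)
          + ((L : ℝ) - 2) ^ 2 * (∑ i ∈ Finset.range L, ((i : ℝ)) ^ 2)) / 4 := by
    rw [Finset.mul_sum, Finset.mul_sum, ← Finset.sum_sub_distrib, ← Finset.sum_add_distrib, Finset.sum_div]
    refine Finset.sum_congr rfl fun i _ => ?_; ring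
  have e1 : ∑ i ∈ Finset.range L, ((((i : ℝ)) ^ 2 - ((L : ℝ) - 2) * i) / 2)
      = ((∑ i ∈ Finset.range L, ((i : ℝ)) ^ 2) - ((L : ℝ) - 2) * (∑ i ∈ Finset.range L, ((i : ℝ)))) / 2 := by
    rw [Finset.mul_sum, ← Finset.sum_sub_distrib, Finset.sum_div]
  rw [e2, e1, sum_range_four, sum_range_cube, sum_range_sq, sum_range_id_real]
  field_simp
  ring

/-- ★ **`SumCscFourth` holds:** `Σ_{n=1}^{L−1} 1/sin⁴(πn/L) = (L² − 1)(L² + 11)/45` for every `L ≥ 1`. [folklore] -/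
theorem sumCscFourth_holds : SumCscFourth := by
  intro L hL
  haveI : NeZero L := ⟨by omega⟩
  classical
  rw [← sum_inv_sin_four_zmod L,
    Literature.AlgebraicTopology.CellComplexes.CubicalTorus.sum_univ_zmod (N := L)
      (fun k : ZMod L => if k = 0 then (0 : ℝ) else 1 / Real.sin (Real.pi * k.val / L) ^ 4)]
  obtain ⟨m, rfl⟩ : ∃ m, L = m + 1 := ⟨L - 1, by omega⟩
  rw [Finset.sum_range_succ', Finset.sum_Ico_eq_sum_range]
  simp only [Nat.cast_zero, if_true, add_zero, show m + 1 - 1 = m from rfl]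
  refine Finset.sum_congr rfl fun i hi => ?_
  have hi' : i + 1 < m + 1 := by have := Finset.mem_range.1 hi; omega
  have hne : ((((i + 1 : ℕ)) : ZMod (m + 1))) ≠ 0 := by
    intro h
    rw [ZMod.natCast_eq_zero_iff] at h
    exact absurd (Nat.le_of_dvd (by omega) h) (by omega)
  rw [if_neg hne, ZMod.val_natCast_of_lt hi']
  push_cast
  ring_nf

end Summit.HubbardSuperconductivity.HubbardSuperconductivity.Theorems.AnisotropyChord.Transfer.Fibre3

end
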